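import Literature.Geometry.Lorentzian.CoordCurvature
import Mathlib.Analysis.SpecialFunctions.Sqrt
import HarnessLib

/-!
# The unit normal to the level hyperplanes of a linear form, in the coordinate tensor calculus
# (lapse of a slicing; O'Neill 1983, Ch. 3, p. 60; Wald 1984, §10.2, (10.2.10) ff.)

Pure Fréchet calculus on a finite-dimensional real normed space `E`, continuing the coordinate
tensor calculus `MetricCoord` of `CoordCurvature.lean` (`IsMetricOn G V`: a field of bilinear
forms, smooth, symmetric and invertible on the open set `V`; index raising `sharpAt G x = ♯`).
Fix a continuous linear form `ℓ : E →L[ℝ] ℝ` (a coordinate function; its level sets `{ℓ = c}` are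
the coordinate slices). The **gradient** of `ℓ` at `x` is `♯_x ℓ` (`G_x(♯ℓ, w) = ℓ w`), and we put

* `lapseSq G ℓ x = -ℓ(♯_x ℓ) = -G_x(♯ℓ, ♯ℓ)` (= `-gˣˣ(dℓ, dℓ)`, the inverse square lapse
  `α⁻² = -g⁰⁰` of the slicing when `ℓ = x⁰`; Wald 1984, (10.2.10));
* `sliceNormal G ℓ x = -(√(lapseSq))⁻¹ • ♯_x ℓ` — the normal to the slices pointing to increasing
  `ℓ`, `N = -α ∇t` (Wald 1984, (10.2.10): "`n^a = -α ∇^a t`").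

Where `lapseSq G ℓ x > 0` — i.e. where the gradient `♯ℓ` is timelike for a metric of Lorentzian
signature, equivalently the slices are spacelike at `x` — we prove:
`G_x(N, w) = -(√lapseSq)⁻¹ ℓ(w)` (`apply_sliceNormal`), so `N ⊥ ker ℓ` (the tangent spaces of the
slices, `apply_sliceNormal_of_mem_ker`), `G_x(N, N) = -1` (`apply_sliceNormal_self`: a unit
timelike vector), `ℓ(N) = √lapseSq > 0` (`form_sliceNormal`: `N` points to increasing `ℓ`), and
`lapseSq`, `sliceNormal` are `C^∞` on `V ∩ {lapseSq > 0}` (`IsMetricOn.contDiffOn_lapseSq`,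
`IsMetricOn.contDiffOn_sliceNormal`; `♯` is smooth, `IsMetricOn.contDiffOn_sharpAt`).

This is the normal field of the coordinate slices `{x⁰ = const}` of a Lorentzian metric read in
a chart whose first coordinate is a time function — the future unit normal of the restarting
hypersurface in the local uniqueness / maximal Cauchy development arguments
(Hawking–Ellis 1973, §7.5; Sbierski 2016, §3.2), with its smoothness for free. No definition of
`Prop` type; everything is proved.

## References

* R. M. Wald, *General Relativity*, University of Chicago Press 1984, §10.2, (10.2.8)–(10.2.13)
  (lapse, unit normal `n^a = -α ∇^a t`). [Wald1984]
* B. O'Neill, *Semi-Riemannian geometry with applications to relativity*, Academic Press 1983,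
  Ch. 3, p. 60 (metrically equivalent vectors and one-forms: the gradient). [ONeill1983]
-/

noncomputable section

open Set Filter ContinuousLinearMap Module
open scoped Topology ContDiff

namespace Literature.Geometry.Lorentzian

namespace MetricCoord

variable {E : Type*} [NormedAddCommGroup E] [NormedSpace ℝ E]

section SliceNormal

variable (G : E → E →L[ℝ] E →L[ℝ] ℝ) (ℓ : E →L[ℝ] ℝ)

/-- The **inverse square lapse** of the slicing by the level sets of the linear form `ℓ`:
`lapseSq x = -ℓ(♯_x ℓ) = -G_x(♯ℓ, ♯ℓ)` (`= -g⁰⁰` for `ℓ = x⁰`). Wald 1984, §10.2, (10.2.10).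
[cite: Wald1984, §10.2, (10.2.10)] -/
def lapseSq (x : E) : ℝ :=
  -ℓ (sharpAt G x ℓ)

/-- The **normal to the slices `{ℓ = c}` pointing to increasing `ℓ`**:
`N_x = -(√(lapseSq x))⁻¹ • ♯_x ℓ` (Wald's `n^a = -α ∇^a t`). Wald 1984, §10.2, (10.2.10).
[cite: Wald1984, §10.2, (10.2.10)] -/
def sliceNormal (x : E) : E :=
  -((Real.sqrt (lapseSq G ℓ x))⁻¹ • sharpAt G x ℓ)

variable {G ℓ} {V : Set E} {x : E}

/-- Unfolding lemma for `lapseSq`. [folklore] -/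
theorem lapseSq_def (x : E) : lapseSq G ℓ x = -ℓ (sharpAt G x ℓ) := rfl

/-- Unfolding lemma for `sliceNormal`. [folklore] -/
theorem sliceNormal_def (x : E) :
    sliceNormal G ℓ x = -((Real.sqrt (lapseSq G ℓ x))⁻¹ • sharpAt G x ℓ) := rfl

/-- `G_x(♯ℓ, ♯ℓ) = ℓ(♯ℓ) = -lapseSq x`. [cite: ONeill1983, Ch. 3, p. 60] -/
theorem apply_sharpAt_self_eq_neg_lapseSq (hx : (G x).IsInvertible) :
    G x (sharpAt G x ℓ) (sharpAt G x ℓ) = -lapseSq G ℓ x := by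
  rw [apply_sharpAt_apply hx, lapseSq_def, neg_neg]

/-- **`G_x(N, w) = -(√lapseSq)⁻¹ ℓ(w)`**: the scalar product with the slice normal is the linear
form, rescaled. Wald 1984, §10.2, (10.2.10). [cite: Wald1984, §10.2, (10.2.10)] -/
theorem apply_sliceNormal (hx : (G x).IsInvertible) (w : E) :
    G x (sliceNormal G ℓ x) w = -((Real.sqrt (lapseSq G ℓ x))⁻¹ * ℓ w) := by
  rw [sliceNormal_def, map_neg, map_smul, neg_apply, smul_apply, apply_sharpAt_apply hx,
    smul_eq_mul]

/-- **The slice normal is orthogonal to the slices**: `G_x(N, w) = 0` for `w ∈ ker ℓ` (the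
tangent space of every level set `{ℓ = c}`). Wald 1984, §10.2. [cite: Wald1984, §10.2, (10.2.10)] -/
theorem apply_sliceNormal_of_mem_ker (hx : (G x).IsInvertible) {w : E} (hw : ℓ w = 0) :
    G x (sliceNormal G ℓ x) w = 0 := by
  rw [apply_sliceNormal hx, hw, mul_zero, neg_zero]

/-- **`ℓ(N) = √lapseSq`**: the slice normal points to increasing `ℓ`, with rate the lapse factor.
Wald 1984, §10.2, (10.2.10)–(10.2.11). [cite: Wald1984, §10.2, (10.2.11)] -/
theorem form_sliceNormal (hpos : 0 < lapseSq G ℓ x) :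
    ℓ (sliceNormal G ℓ x) = Real.sqrt (lapseSq G ℓ x) := by
  have hs : 0 < Real.sqrt (lapseSq G ℓ x) := Real.sqrt_pos.2 hpos
  rw [sliceNormal_def, map_neg, map_smul, smul_eq_mul]
  have h : ℓ (sharpAt G x ℓ) = -lapseSq G ℓ x := by rw [lapseSq_def, neg_neg]
  rw [h, mul_neg, neg_neg, inv_mul_eq_iff_eq_mul₀ hs.ne']
  exact (Real.mul_self_sqrt hpos.le).symm

/-- **The slice normal is a unit timelike vector**: `G_x(N, N) = -1` where `lapseSq x > 0`.
Wald 1984, §10.2, (10.2.10) (`n^a n_a = -1`). [cite: Wald1984, §10.2, (10.2.10)] -/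
theorem apply_sliceNormal_self (hx : (G x).IsInvertible) (hpos : 0 < lapseSq G ℓ x) :
    G x (sliceNormal G ℓ x) (sliceNormal G ℓ x) = -1 := by
  have hs : 0 < Real.sqrt (lapseSq G ℓ x) := Real.sqrt_pos.2 hpos
  rw [apply_sliceNormal hx, form_sliceNormal hpos, inv_mul_cancel₀ hs.ne']

/-- The slice normal is nonzero where `lapseSq x > 0`. [folklore] -/
theorem sliceNormal_ne_zero (hx : (G x).IsInvertible) (hpos : 0 < lapseSq G ℓ x) :
    sliceNormal G ℓ x ≠ 0 := fun h ↦ by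
  have h1 := apply_sliceNormal_self (ℓ := ℓ) hx hpos
  rw [h, map_zero] at h1
  norm_num at h1

/-- Positivity of `lapseSq` is timelikeness of the gradient: `0 < lapseSq x ↔ G_x(♯ℓ, ♯ℓ) < 0`.
[cite: Wald1984, §10.2, (10.2.10)] -/
theorem lapseSq_pos_iff (hx : (G x).IsInvertible) :
    0 < lapseSq G ℓ x ↔ G x (sharpAt G x ℓ) (sharpAt G x ℓ) < 0 := by
  rw [apply_sharpAt_self_eq_neg_lapseSq hx, neg_lt_zero]

/-! ### Smoothness -/

/-- `lapseSq` is `C^∞` on `V` (so is `♯`, `IsMetricOn.contDiffOn_sharpAt`). [folklore] -/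
theorem IsMetricOn.contDiffOn_lapseSq [CompleteSpace E] (hG : IsMetricOn G V) :
    ContDiffOn ℝ ∞ (lapseSq G ℓ) V := by
  have h1 : ContDiffOn ℝ ∞ (fun x ↦ sharpAt G x ℓ) V :=
    hG.contDiffOn_sharpAt.clm_apply contDiffOn_const
  have h2 : ContDiffOn ℝ ∞ (fun x ↦ ℓ (sharpAt G x ℓ)) V := ℓ.contDiff.comp_contDiffOn h1
  exact h2.neg

/-- `lapseSq` is `C^∞` at the points of `V`. [folklore] -/
theorem IsMetricOn.contDiffAt_lapseSq [CompleteSpace E] (hG : IsMetricOn G V) (hx : x ∈ V) :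
    ContDiffAt ℝ ∞ (lapseSq G ℓ) x :=
  (hG.contDiffOn_lapseSq x hx).contDiffAt (hG.mem_nhds hx)

/-- **The slice normal is a `C^∞` vector field** on `V ∩ {lapseSq > 0}` (smoothness of `♯`, of
`√` away from `0` and of inversion away from `0`). O'Neill 1983, Ch. 4, Lemma 4.19 ff. (local
smooth unit normals); here explicit. [folklore] -/
theorem IsMetricOn.contDiffAt_sliceNormal [CompleteSpace E] (hG : IsMetricOn G V) (hx : x ∈ V)
    (hpos : 0 < lapseSq G ℓ x) : ContDiffAt ℝ ∞ (sliceNormal G ℓ) x := by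
  have h1 : ContDiffAt ℝ ∞ (fun x ↦ sharpAt G x ℓ) x :=
    (hG.contDiffAt_sharpAt hx).clm_apply contDiffAt_const
  have h2 : ContDiffAt ℝ ∞ (fun x ↦ Real.sqrt (lapseSq G ℓ x)) x :=
    (hG.contDiffAt_lapseSq hx).sqrt hpos.ne'
  have h3 : ContDiffAt ℝ ∞ (fun x ↦ (Real.sqrt (lapseSq G ℓ x))⁻¹) x :=
    h2.inv (Real.sqrt_pos.2 hpos).ne'
  exact (h3.smul h1).neg

/-- The slice normal is `C^∞` on `V ∩ {lapseSq > 0}`. [folklore] -/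
theorem IsMetricOn.contDiffOn_sliceNormal [CompleteSpace E] (hG : IsMetricOn G V) :
    ContDiffOn ℝ ∞ (sliceNormal G ℓ) (V ∩ {x | 0 < lapseSq G ℓ x}) := fun _ hx ↦
  (hG.contDiffAt_sliceNormal hx.1 hx.2).contDiffWithinAt

/-- The set where the slices are spacelike, `V ∩ {lapseSq > 0}`, is open. [folklore] -/
theorem IsMetricOn.isOpen_inter_lapseSq_pos [CompleteSpace E] (hG : IsMetricOn G V) :
    IsOpen (V ∩ {x | 0 < lapseSq G ℓ x}) :=
  hG.contDiffOn_lapseSq.continuousOn.isOpen_inter_preimage hG.isOpen isOpen_Ioi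

end SliceNormal

end MetricCoord

end Literature.Geometry.Lorentzian

end
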